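import Literature.AlgebraicGeometry.Motives.PlaneFamilyRelation
import Literature.AlgebraicGeometry.Motives.CubicHypersurfacePlanesRatEquiv
import Literature.AlgebraicGeometry.Motives.LinesGenerateChowOneSumSq
import Literature.RingTheory.MvPolynomial.CubicFormPlaneChainsCr
import Mathlib.LinearAlgebra.LinearIndependent.BaseChange
import HarnessLib

/-!
# A family of lines of a cubic hypersurface over a curve is rationally equivalent to a sum of planes

Stage 2 of the product-trick argument for `2`-cycles on a cubic hypersurface `X = V₊(F) ⊆ ℙᵈ⁺¹_k`
(`k` algebraically closed, `d ≥ 14`): let `B` be a smooth proper curve, `K = k(B)` (`C₁` for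
systems, Tsen–Lang), and `λ` a `K`-line of the generic fibre `X_K`. Then the push-forward to `X` of
the closure `S_λ ⊆ X ×ₖ B` of `λ` — the surface of `X` swept by the family of lines — is rationally
equivalent ON `X` to an integral combination of PLANES of `X`:

* any two `K`-lines of `X_K` are joined by a chain of `K`-lines in which consecutive ones span a
  `K`-plane of `X_K` (`Literature.RingTheory.MvPolynomial.reflTransGen_coplanar_of_isCrSystem_one`,
  `d + 1 ≥ 15`);
* for two `K`-lines in a common `K`-plane, the plane-family relation
  (`ProjFamily.exists_relation_of_two_lines_on_plane`, `Motives/PlaneFamilyRelation`) pushed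
  forward along the proper projection `X ×ₖ B → X` (Fulton Thm. 1.4) shows that the two swept
  surfaces differ by planes modulo `Rat₂(X)`;
* the constant family `λ₀ ⊗ K` of a `k`-line `λ₀ ⊆ X` is contracted by the projection.

Main statement: `ProjFamily.exists_planes_of_line` (for a point `x` of `X_K` over a line of
`ℙᵈ⁺¹_K`, the push-forward of `[closure (ι x)]` is rationally equivalent to `Σ nᵢ [Πᵢ]`, `Πᵢ`
planes of `X`). This is the role played in Mboro's proof of Cor. 2.9 (i) by Thm. 2.8
(`CH₁(F(X))` generated by lines, pushed to `X` by the universal line), in the elementary range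
`d ≥ 14`. Everything is proved; no definitions, no named facts.

## References

* [TianZong2014] Z. Tian, H. R. Zong, *One-cycles on rationally connected varieties*, Compositio
  Math. 150 (2014), proof of Prop. 7.2 (the product trick, one dimension down).
* [Mboro2018] R. Mboro, *Remarks on the CH₂ of cubic hypersurfaces*, arXiv:1701.04488, Thm. 2.8,
  Cor. 2.9.
* [Fulton1998] W. Fulton, *Intersection Theory*, Thm. 1.4, §1.4, §10.1.
-/

noncomputable section

open CategoryTheory CategoryTheory.Limits AlgebraicGeometry MonoidalCategory MvPolynomial
  TopologicalSpace Order

universe u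

namespace Literature.AlgebraicGeometry.Motives

attribute [local instance] MvPolynomial.gradedAlgebra MvPolynomial.algebraMvPolynomial
  Literature.AlgebraicGeometry.Motives.ProjBaseChange.algebraBase
  UniversalHyperplaneSection.sectionsAlgebra ProjFamily.functionFieldAlgebra

namespace ProjFamily

open ProjBaseChangeRing ProjectiveSpaceCells ProjectiveSpace Literature.RingTheory.MvPolynomial

variable {k : Type u} [Field k]

/-! ### The generic fibre of a hypersurface and its linear-subspace points -/

section GenericFibre

variable [IsAlgClosed k] {d : ℕ} (B : SchemeOver k) [IsIntegral B.left]
  (X : SchemeOver k) (i : X ⟶ projectiveSpace (d + 1) k) [IsClosedImmersion i.left]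
  {F : MvPolynomial (Fin (d + 1 + 1)) k}
  (hrange : Set.range i.left.base =
    ProjectiveSpectrum.zeroLocus (homogeneousSubmodule (Fin (d + 1 + 1)) k) {F})

include hrange in
omit [IsAlgClosed k] [IsClosedImmersion i.left] in
/-- **The generic fibre of the hypersurface `X = V₊(F)` is the hypersurface `V₊(F ⊗ 1) ⊆ ℙ_K`**:
the image of `X_K → ℙᵈ⁺¹_K` is the zero locus of `F` extended to `K = k(B)`. [folklore] -/
theorem range_iK_eq_zeroLocus :
    Set.range (iK (d + 1) B X i).base =
      ProjectiveSpectrum.zeroLocus (homogeneousSubmodule (Fin (d + 1 + 1)) B.left.functionField)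
        {MvPolynomial.map (algebraMap k B.left.functionField) F} := by
  ext x
  rw [range_iK (d + 1) B X i, Set.mem_preimage, range_whiskerRight_left (d + 1) B X i,
    Set.mem_preimage, hrange]
  have hfst : (CartesianMonoidalCategory.fst (projectiveSpace (d + 1) k) B).left.base
      ((genericFibreι (d + 1) B).base x) =
        (Proj.map (mapGraded k B.left.functionField (Fin (d + 1 + 1)))
          (irrelevant_le_map k B.left.functionField (Fin (d + 1 + 1)))).base x := by
    change ((genericFibreι (d + 1) B ≫
      (CartesianMonoidalCategory.fst (projectiveSpace (d + 1) k) B).left).base x) = _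
    rw [genericFibreι_fst]
    rfl
  rw [hfst]
  constructor
  · intro h
    have hF : F ∈ ProjectiveSpectrum.asHomogeneousIdeal (𝒜 := homogeneousSubmodule (Fin (d + 1 + 1)) k)
        ((Proj.map (mapGraded k B.left.functionField (Fin (d + 1 + 1)))
          (irrelevant_le_map k B.left.functionField (Fin (d + 1 + 1)))).base x) :=
      (ProjectiveSpectrum.mem_zeroLocus _ _ _).1 h (Set.mem_singleton F)
    exact (ProjectiveSpectrum.mem_zeroLocus _ _ _).2 (Set.singleton_subset_iff.2
      ((ProjectiveSpectrum.mem_asHomogeneousIdeal_map_iff x F).1 hF))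
  · intro h
    have hF : MvPolynomial.map (algebraMap k B.left.functionField) F ∈
        ProjectiveSpectrum.asHomogeneousIdeal
          (𝒜 := homogeneousSubmodule (Fin (d + 1 + 1)) B.left.functionField) x :=
      (ProjectiveSpectrum.mem_zeroLocus _ _ _).1 h (Set.mem_singleton _)
    exact (ProjectiveSpectrum.mem_zeroLocus _ _ _).2 (Set.singleton_subset_iff.2
      ((ProjectiveSpectrum.mem_asHomogeneousIdeal_map_iff x F).2 hF))

include hrange in
/-- **Linear-subspace points of the generic fibre from isotropic frames**: for `r + 1` independent
vectors of `Kᵈ⁺²` on whose span `F ⊗ 1` vanishes there is a point `x ∈ X_K` over the generic point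
of the `r`-plane they span, whose homogeneous prime (in `ℙᵈ⁺¹_K`) consists of the polynomials
vanishing on that span (`Hypersurface.exists_isLinearSubspacePoint_of_frame` for
`X_K ↪ ℙᵈ⁺¹_K`). [folklore] -/
theorem exists_point_of_frame {r m : ℕ} (hm : m = r + 1) (hr : r ≤ d + 1)
    {w : Fin m → Fin (d + 1 + 1) → B.left.functionField}
    (hw : LinearIndependent B.left.functionField w)
    (hiso : ∀ v ∈ Submodule.span B.left.functionField (Set.range w),
      eval v (MvPolynomial.map (algebraMap k B.left.functionField) F) = 0) :
    ∃ x : ↥(XK B X),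
      IsLinearSubspacePoint r (d + 1) (𝟙 (projectiveSpace (d + 1) B.left.functionField))
        ((iK (d + 1) B X i).base x) ∧
      ∀ G : MvPolynomial (Fin (d + 1 + 1)) B.left.functionField,
        G ∈ (ProjectiveSpectrum.asHomogeneousIdeal
          (𝒜 := homogeneousSubmodule (Fin (d + 1 + 1)) B.left.functionField)
            ((iK (d + 1) B X i).base x)).toIdeal ↔
          ∀ v ∈ Submodule.span B.left.functionField (Set.range w), eval v G = 0 := by
  haveI : Infinite k := IsAlgClosed.instInfinite
  haveI : Infinite B.left.functionField := Infinite.of_injective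
    (algebraMap k B.left.functionField) (algebraMap k B.left.functionField).injective
  let XK' : SchemeOver B.left.functionField :=
    Over.mk (iK (d + 1) B X i ≫ (projectiveSpace (d + 1) B.left.functionField).hom)
  let iK' : XK' ⟶ projectiveSpace (d + 1) B.left.functionField := Over.homMk (iK (d + 1) B X i) rfl
  haveI : IsClosedImmersion iK'.left := inferInstanceAs (IsClosedImmersion (iK (d + 1) B X i))
  have hrange' : Set.range iK'.left.base = ProjectiveSpectrum.zeroLocus
      (homogeneousSubmodule (Fin (d + 1 + 1)) B.left.functionField)
        {MvPolynomial.map (algebraMap k B.left.functionField) F} :=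
    range_iK_eq_zeroLocus B X i hrange
  obtain ⟨μ, hμ, hA⟩ := Hypersurface.exists_isLinearSubspacePoint_of_frame iK' hrange' hm hr hw hiso
  exact ⟨μ, hμ.base_of_isClosedImmersion, hA⟩

include hrange in
/-- A point of `X_K` whose homogeneous prime consists of the polynomials vanishing on a
`2`-dimensional isotropic subspace is a line point of `ℙᵈ⁺¹_K`. [folklore] -/
theorem isLinearSubspacePoint_one_of_assoc {ℓ : Submodule B.left.functionField
      (Fin (d + 1 + 1) → B.left.functionField)}
    (hℓ : Module.finrank B.left.functionField ℓ = 2)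
    (hiso : ∀ v ∈ ℓ, eval v (MvPolynomial.map (algebraMap k B.left.functionField) F) = 0)
    {x : ↥(XK B X)}
    (hx : ∀ G : MvPolynomial (Fin (d + 1 + 1)) B.left.functionField,
      G ∈ (ProjectiveSpectrum.asHomogeneousIdeal
        (𝒜 := homogeneousSubmodule (Fin (d + 1 + 1)) B.left.functionField)
          ((iK (d + 1) B X i).base x)).toIdeal ↔ ∀ v ∈ ℓ, eval v G = 0) :
    IsLinearSubspacePoint 1 (d + 1) (𝟙 (projectiveSpace (d + 1) B.left.functionField))
      ((iK (d + 1) B X i).base x) := by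
  obtain ⟨w, hw, hspan⟩ := exists_frame_of_finrank_eq hℓ
  obtain ⟨x₁, hx₁, hA₁⟩ := exists_point_of_frame B X i hrange (r := 1) (m := 2) rfl (by omega) hw
    (by rw [hspan]; exact hiso)
  rw [hspan] at hA₁
  -- `x₁ = x`: same homogeneous prime
  let XK' : SchemeOver B.left.functionField :=
    Over.mk (iK (d + 1) B X i ≫ (projectiveSpace (d + 1) B.left.functionField).hom)
  let iK' : XK' ⟶ projectiveSpace (d + 1) B.left.functionField := Over.homMk (iK (d + 1) B X i) rfl
  haveI : IsClosedImmersion iK'.left := inferInstanceAs (IsClosedImmersion (iK (d + 1) B X i))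
  have heq : x₁ = x := Hypersurface.eq_of_submodule_eq iK' hA₁ hx
  rw [← heq]
  exact hx₁

end GenericFibre

/-! ### The relation for one link of the chain -/

section Link

variable [IsAlgClosed k] {d : ℕ} (B : SchemeOver k) [IsIntegral B.left] [LocallyOfFiniteType B.hom]
  (X : SchemeOver k) (i : X ⟶ projectiveSpace (d + 1) k) [IsClosedImmersion i.left]
  {F : MvPolynomial (Fin (d + 1 + 1)) k}
  (hrange : Set.range i.left.base =
    ProjectiveSpectrum.zeroLocus (homogeneousSubmodule (Fin (d + 1 + 1)) k) {F})

include hrange in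
/-- **The relation for one link of the chain.** Let `ℓ, ℓ'' ⊆ π` be `2`-dimensional subspaces of
`Kᵈ⁺²` inside a `3`-dimensional subspace `π` on which `F ⊗ 1` vanishes (two `K`-lines in a
`K`-plane of `X_K`), and `x, x'' ∈ X_K` the points over the two lines. Then there are
`c' ∈ Rat₂(X ×ₖ B)` and `vert` with `c' = [ι x] - [ι x''] + vert` such that every `z` with
`vert z ≠ 0` projects to a PLANE point of `i : X ⊆ ℙᵈ⁺¹_k`
(`ProjFamily.exists_relation_of_two_lines_on_plane`). [cite: TianZong2014, proofs of Prop. 3.1 and Prop. 7.2] -/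
theorem exists_relation_of_link (hd : 1 ≤ d) (hB1 : height (genericPoint B.left) = 1)
    (hpid : ∀ b : B.left, IsClosed ({b} : Set B.left) →
      IsPrincipalIdealRing (B.left.presheaf.stalk b))
    {ℓ ℓ'' π : Submodule B.left.functionField (Fin (d + 1 + 1) → B.left.functionField)}
    (hℓ : Module.finrank B.left.functionField ℓ = 2)
    (hℓ'' : Module.finrank B.left.functionField ℓ'' = 2)
    (hπ : Module.finrank B.left.functionField π = 3) (hℓπ : ℓ ≤ π) (hℓ''π : ℓ'' ≤ π)
    (hπiso : ∀ v ∈ π, eval v (MvPolynomial.map (algebraMap k B.left.functionField) F) = 0)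
    {x x'' : ↥(XK B X)}
    (hx : ∀ G : MvPolynomial (Fin (d + 1 + 1)) B.left.functionField,
      G ∈ (ProjectiveSpectrum.asHomogeneousIdeal
        (𝒜 := homogeneousSubmodule (Fin (d + 1 + 1)) B.left.functionField)
          ((iK (d + 1) B X i).base x)).toIdeal ↔ ∀ v ∈ ℓ, eval v G = 0)
    (hx'' : ∀ G : MvPolynomial (Fin (d + 1 + 1)) B.left.functionField,
      G ∈ (ProjectiveSpectrum.asHomogeneousIdeal
        (𝒜 := homogeneousSubmodule (Fin (d + 1 + 1)) B.left.functionField)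
          ((iK (d + 1) B X i).base x'')).toIdeal ↔ ∀ v ∈ ℓ'', eval v G = 0) :
    ∃ c' ∈ ratTrivial (X ⊗ B).left 2, ∃ vert : AlgebraicCycle (X ⊗ B).left ℤ,
      c' = primeCycle ((ιX B X).base x) - primeCycle ((ιX B X).base x'') + vert ∧
      ∀ z, vert z ≠ 0 → IsLinearSubspacePoint 2 (d + 1) i
        ((CartesianMonoidalCategory.fst X B).left.base z) := by
  classical
  haveI : Infinite k := IsAlgClosed.instInfinite
  haveI : Infinite B.left.functionField := Infinite.of_injective
    (algebraMap k B.left.functionField) (algebraMap k B.left.functionField).injective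
  let XK' : SchemeOver B.left.functionField :=
    Over.mk (iK (d + 1) B X i ≫ (projectiveSpace (d + 1) B.left.functionField).hom)
  let iK' : XK' ⟶ projectiveSpace (d + 1) B.left.functionField := Over.homMk (iK (d + 1) B X i) rfl
  haveI : IsClosedImmersion iK'.left := inferInstanceAs (IsClosedImmersion (iK (d + 1) B X i))
  have hinjK : Function.Injective (iK (d + 1) B X i).base := (iK (d + 1) B X i).isClosedEmbedding.injective
  -- the point of the plane `π` and its equations `μ`
  obtain ⟨f, hf, hspanπ⟩ := exists_frame_of_finrank_eq hπ
  obtain ⟨xπ, hxπ, hAπ⟩ := exists_point_of_frame B X i hrange (r := 2) (m := 3) rfl (by omega) hf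
    (by rw [hspanπ]; exact hπiso)
  rw [hspanπ] at hAπ
  obtain ⟨μ, hμli, hμhom, -, hspanμ, -⟩ := hxπ.exists_eq_span_of_id
  -- the two lines are line points specialising from `xπ`
  have hx1 := isLinearSubspacePoint_one_of_assoc B X i hrange hℓ (fun v hv => hπiso v (hℓπ hv)) hx
  have hx''1 := isLinearSubspacePoint_one_of_assoc B X i hrange hℓ'' (fun v hv => hπiso v (hℓ''π hv)) hx''
  have hsp : (iK (d + 1) B X i).base xπ ⤳ (iK (d + 1) B X i).base x :=
    (Hypersurface.specializes_of_submodule_le iK' hℓπ hAπ hx).map (iK (d + 1) B X i).base.hom.continuous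
  have hsp'' : (iK (d + 1) B X i).base xπ ⤳ (iK (d + 1) B X i).base x'' :=
    (Hypersurface.specializes_of_submodule_le iK' hℓ''π hAπ hx'').map
      (iK (d + 1) B X i).base.hom.continuous
  have hws : height ((iK (d + 1) B X i).base xπ) = ((1 + 1 : ℕ) : ℕ∞) := hxπ.height_eq
  have hc : d + 1 - 2 + 1 ≤ d + 1 := by omega
  obtain ⟨ℓu, hℓu, hindu, hspanu⟩ :=
    ProjSpace.exists_snoc_presentation_of_specializes μ hμli hμhom hspanμ hws hx1 hsp hc
  obtain ⟨ℓv, hℓv, hindv, hspanv⟩ :=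
    ProjSpace.exists_snoc_presentation_of_specializes μ hμli hμhom hspanμ hws hx''1 hsp'' hc
  -- the plane lies in `X_K`
  have hplane : ProjectiveSpectrum.zeroLocus
      (homogeneousSubmodule (Fin (d + 1 + 1)) B.left.functionField) (Set.range μ) ⊆
        Set.range (iK (d + 1) B X i).base := by
    have hFπ : MvPolynomial.map (algebraMap k B.left.functionField) F ∈ Ideal.span (Set.range μ) := by
      rw [← hspanμ]
      have hmem : (iK (d + 1) B X i).base xπ ∈ Set.range (iK (d + 1) B X i).base := ⟨xπ, rfl⟩
      have hmem' := (Set.ext_iff.mp (range_iK_eq_zeroLocus B X i hrange) _).mp hmem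
      exact (ProjectiveSpectrum.mem_zeroLocus _ _ _).1 hmem' (Set.mem_singleton _)
    intro q hq
    refine (Set.ext_iff.mp (range_iK_eq_zeroLocus B X i hrange) q).mpr ?_
    refine (ProjectiveSpectrum.mem_zeroLocus _ _ _).2 (Set.singleton_subset_iff.2 ?_)
    have hle : Ideal.span (Set.range μ) ≤ (ProjectiveSpectrum.asHomogeneousIdeal
        (𝒜 := homogeneousSubmodule (Fin (d + 1 + 1)) B.left.functionField) q).toIdeal :=
      Ideal.span_le.2 fun _ ⟨l, hl⟩ => hl ▸ hq ⟨l, rfl⟩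
    exact hle hFπ
  -- the plane-family relation
  obtain ⟨c', hc', uX, vX, huI, hvI, vert, hcv, hvert⟩ :=
    exists_relation_of_two_lines_on_plane B X i (by omega) hB1 hpid μ hμli hμhom hplane hℓu hℓv
      hindu hindv
  -- `uX = x`, `vX = x''`
  have heq : ∀ {y y' : ↥(XK B X)},
      (ProjectiveSpectrum.asHomogeneousIdeal
        (𝒜 := homogeneousSubmodule (Fin (d + 1 + 1)) B.left.functionField)
          ((iK (d + 1) B X i).base y)).toIdeal =
      (ProjectiveSpectrum.asHomogeneousIdeal
        (𝒜 := homogeneousSubmodule (Fin (d + 1 + 1)) B.left.functionField)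
          ((iK (d + 1) B X i).base y')).toIdeal → y = y' := by
    intro y y' h
    apply hinjK
    apply ProjectiveSpectrum.ext
    exact HomogeneousIdeal.ext h
  have hux : uX = x := heq (huI.trans hspanu.symm)
  have hvx : vX = x'' := heq (hvI.trans hspanv.symm)
  refine ⟨c', hc', vert, by rw [hcv, hux, hvx], fun z hz => ?_⟩
  obtain ⟨-, -, L, hLli, hLhom, hcl⟩ := hvert z hz
  -- the projection is a plane point
  have hle : d + 1 - 2 ≤ d + 1 := Nat.sub_le _ _
  have hpt : i.left.base ((CartesianMonoidalCategory.fst X B).left.base z) =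
      linearSubspacePoint L hLli hLhom hle :=
    eq_linearSubspacePoint_of_closure_eq L hLli hLhom hle hcl
  refine ⟨?_, L, hLli, hLhom, ?_⟩
  · rw [← height_base_eq_of_isClosedImmersion' i.left, hpt, height_linearSubspacePoint]
    have : d + 1 - (d + 1 - 2) = 2 := by omega
    rw [this]
  · rw [← i.left.isClosedEmbedding.closure_image_eq, Set.image_singleton, hcl]

end Link

/-! ### Push-forward to `X`: chains, the constant line, and the main statement -/

section Main

open Literature.FieldTheory.QuasiAlgClosed

variable [IsAlgClosed k] {d : ℕ} (B : SchemeOver k) [IsIntegral B.left] [IsProper B.hom]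
  (X : SchemeOver k) (i : X ⟶ projectiveSpace (d + 1) k) [IsClosedImmersion i.left]
  {F : MvPolynomial (Fin (d + 1 + 1)) k}
  (hrange : Set.range i.left.base =
    ProjectiveSpectrum.zeroLocus (homogeneousSubmodule (Fin (d + 1 + 1)) k) {F})

omit [IsAlgClosed k] [IsProper B.hom] in
/-- An `r`-plane point of `ℙᵈ⁺¹_K` in the image of `X_K` is an `r`-plane point of `X_K ↪ ℙᵈ⁺¹_K`
(the converse of `IsLinearSubspacePoint.base_of_isClosedImmersion` for `iK`). [folklore] -/
theorem isLinearSubspacePoint_iK_of_id {r : ℕ} {x : ↥(XK B X)}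
    (hx : IsLinearSubspacePoint r (d + 1) (𝟙 (projectiveSpace (d + 1) B.left.functionField))
      ((iK (d + 1) B X i).base x)) :
    IsLinearSubspacePoint r (d + 1)
      (Over.homMk (iK (d + 1) B X i) rfl :
        Over.mk (iK (d + 1) B X i ≫ (projectiveSpace (d + 1) B.left.functionField).hom) ⟶
          projectiveSpace (d + 1) B.left.functionField) x := by
  obtain ⟨hh, L, hL, hhom, hcl⟩ := hx
  refine ⟨?_, L, hL, hhom, ?_⟩
  · have h := height_base_eq_of_isClosedImmersion' (iK (d + 1) B X i) x
    rw [hh] at h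
    exact h.symm
  · have hcl' := IsLinearSubspacePoint.closure_eq_of_id hcl
    change ⇑(iK (d + 1) B X i).base '' closure {x} = _
    rw [← (iK (d + 1) B X i).isClosedEmbedding.closure_image_eq, Set.image_singleton]
    exact hcl'

include hrange in
/-- **A family of lines over a curve is rationally equivalent to a sum of planes** (Stage 2 of the
product trick for `2`-cycles). Let `X = V₊(F) ⊆ ℙᵈ⁺¹_k` be a cubic hypersurface (`F` a cubic form,
`k` algebraically closed, `d ≥ 14`), `B` an integral proper `k`-scheme with generic point of
dimension `1`, principal local rings at closed points and `trdeg_k k(B) = 1` (a smooth proper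
curve), `K = k(B)`, and `x ∈ X_K` a point over (the generic point of) a `K`-line of `ℙᵈ⁺¹_K`. Then
the push-forward to `X` of the prime cycle of `ι x ∈ X ×ₖ B` (the surface swept by the family of
lines, with multiplicity) is rationally equivalent on `X` to an integral combination of prime cycles
of PLANES of `X`: the `K`-line is joined to a constant line `λ₀ ⊗ K` by a chain of `K`-lines,
consecutive ones in a common `K`-plane of `X_K` (Tsen–Lang,
`reflTransGen_coplanar_of_isCrSystem_one`); each link contributes planes modulo `Rat₂(X)`
(`exists_relation_of_link` pushed forward along the proper `X ×ₖ B → X`, Fulton Thm. 1.4); the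
constant line is contracted. [cite: TianZong2014, Prop. 7.2 (proof)] [cite: Mboro2018, Thm. 2.8 and Cor. 2.9] -/
theorem exists_planes_of_line (hd : 14 ≤ d) (hB1 : height (genericPoint B.left) = 1)
    (hpid : ∀ b : B.left, IsClosed ({b} : Set B.left) →
      IsPrincipalIdealRing (B.left.presheaf.stalk b))
    (htr : Algebra.trdeg k B.left.functionField = 1) (hF3 : F.IsHomogeneous 3)
    [QuasiCompact (CartesianMonoidalCategory.fst X B).left] (x : ↥(XK B X))
    (hx : IsLinearSubspacePoint 1 (d + 1) (𝟙 (projectiveSpace (d + 1) B.left.functionField))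
      ((iK (d + 1) B X i).base x)) :
    ∃ (s : Finset ↥X.left) (w : ↥X.left → ℤ), (∀ y ∈ s, IsLinearSubspacePoint 2 (d + 1) i y) ∧
      IsRationallyEquivalent
        (AlgebraicCycle.map (CartesianMonoidalCategory.fst X B).left height height
          (primeCycle ((ιX B X).base x)))
        (∑ y ∈ s, w y • primeCycle y) 2 := by
  classical
  -- instances
  haveI : IsProper (projectiveSpace (d + 1) k).hom := isProper_projectiveSpace (d + 1) k
  haveI : IsProper X.hom := by rw [← Over.w i]; infer_instance
  haveI : LocallyOfFiniteType (X ⊗ B).hom :=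
    inferInstanceAs (LocallyOfFiniteType (pullback.fst X.hom B.hom ≫ X.hom))
  haveI : IsProper (CartesianMonoidalCategory.fst X B).left :=
    inferInstanceAs (IsProper (pullback.fst X.hom B.hom))
  haveI : QuasiCompact (X ⊗ B).hom :=
    inferInstanceAs (QuasiCompact (pullback.fst X.hom B.hom ≫ X.hom))
  haveI : CompactSpace ↥(X ⊗ B).left := compactSpace_of_quasiCompact_hom (X ⊗ B)
  haveI : Infinite k := IsAlgClosed.instInfinite
  haveI : Infinite B.left.functionField := Infinite.of_injective
    (algebraMap k B.left.functionField) (algebraMap k B.left.functionField).injective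
  have hK : IsCrSystem 1 B.left.functionField := isCrSystem_one_of_trdeg_eq_one htr
  have hF3K : (MvPolynomial.map (algebraMap k B.left.functionField) F).IsHomogeneous 3 := hF3.map _
  let XK' : SchemeOver B.left.functionField :=
    Over.mk (iK (d + 1) B X i ≫ (projectiveSpace (d + 1) B.left.functionField).hom)
  let iK' : XK' ⟶ projectiveSpace (d + 1) B.left.functionField := Over.homMk (iK (d + 1) B X i) rfl
  haveI : IsClosedImmersion iK'.left := inferInstanceAs (IsClosedImmersion (iK (d + 1) B X i))
  have hrange' : Set.range iK'.left.base = ProjectiveSpectrum.zeroLocus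
      (homogeneousSubmodule (Fin (d + 1 + 1)) B.left.functionField)
        {MvPolynomial.map (algebraMap k B.left.functionField) F} :=
    range_iK_eq_zeroLocus B X i hrange
  have hP := isPullback_ιX B X
  have hi := range_qgen B
  -- push-forward along `pr₁ : X × B → X`
  let M : AlgebraicCycle (X ⊗ B).left ℤ →+ AlgebraicCycle X.left ℤ :=
    AddMonoidHom.mk' (AlgebraicCycle.map (CartesianMonoidalCategory.fst X B).left height height)
      (algebraicCycleMap_add _ height height)
  have hMrat : ∀ c' ∈ ratTrivial (X ⊗ B).left 2, M c' ∈ ratTrivial X.left 2 :=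
    fun c' hc' => map_mem_ratTrivial_holds (d := 2) (CartesianMonoidalCategory.fst X B) hc'
  -- vertical cycles push forward to cycles supported on plane points
  have key_plane : ∀ V : AlgebraicCycle (X ⊗ B).left ℤ,
      (∀ z, V z ≠ 0 → IsLinearSubspacePoint 2 (d + 1) i
        ((CartesianMonoidalCategory.fst X B).left.base z)) →
      ∀ y, (M V) y ≠ 0 → IsLinearSubspacePoint 2 (d + 1) i y := by
    intro V hV y hy
    have hsupp := support_map_subset (CartesianMonoidalCategory.fst X B).left V
      (finite_support_of_compactSpace V).toFinset (by rw [Set.Finite.coe_toFinset])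
    have hy' : y ∈ ((finite_support_of_compactSpace V).toFinset.image
        (CartesianMonoidalCategory.fst X B).left.base : Set _) := hsupp hy
    rw [Finset.coe_image] at hy'
    obtain ⟨z, hz, rfl⟩ := hy'
    exact hV z (Function.mem_support.mp ((Set.Finite.mem_toFinset _).mp hz))
  -- "good differences": `c - c' - P ∈ Rat₂(X)` with `P` supported on plane points
  have good_refl : ∀ c : AlgebraicCycle X.left ℤ, ∃ P : AlgebraicCycle X.left ℤ,
      (∀ y, P y ≠ 0 → IsLinearSubspacePoint 2 (d + 1) i y) ∧ c - c - P ∈ ratTrivial X.left 2 :=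
    fun c => ⟨0, fun y hy => absurd rfl hy, by rw [sub_self, sub_zero]; exact zero_mem _⟩
  have good_trans : ∀ {c c' c'' : AlgebraicCycle X.left ℤ},
      (∃ P : AlgebraicCycle X.left ℤ, (∀ y, P y ≠ 0 → IsLinearSubspacePoint 2 (d + 1) i y) ∧
        c - c' - P ∈ ratTrivial X.left 2) →
      (∃ P : AlgebraicCycle X.left ℤ, (∀ y, P y ≠ 0 → IsLinearSubspacePoint 2 (d + 1) i y) ∧
        c' - c'' - P ∈ ratTrivial X.left 2) →
      ∃ P : AlgebraicCycle X.left ℤ, (∀ y, P y ≠ 0 → IsLinearSubspacePoint 2 (d + 1) i y) ∧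
        c - c'' - P ∈ ratTrivial X.left 2 := by
    rintro c c' c'' ⟨P, hP, hr⟩ ⟨P', hP', hr'⟩
    refine ⟨P + P', fun y hy => ?_, ?_⟩
    · by_cases h : P y = 0
      · have : P' y ≠ 0 := by
          intro h'
          apply hy
          rw [Function.locallyFinsuppWithin.coe_add, Pi.add_apply, h, h', add_zero]
        exact hP' y this
      · exact hP y h
    · have := add_mem hr hr'
      convert this using 1
      abel
  -- one link of the chain
  have good_link : ∀ {ℓ ℓ'' π : Submodule B.left.functionField
      (Fin (d + 1 + 1) → B.left.functionField)},
      Module.finrank B.left.functionField ℓ = 2 → Module.finrank B.left.functionField ℓ'' = 2 →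
      Module.finrank B.left.functionField π = 3 → ℓ ≤ π → ℓ'' ≤ π →
      (∀ v ∈ π, eval v (MvPolynomial.map (algebraMap k B.left.functionField) F) = 0) →
      ∀ {y y'' : ↥(XK B X)},
      (∀ G : MvPolynomial (Fin (d + 1 + 1)) B.left.functionField,
        G ∈ (ProjectiveSpectrum.asHomogeneousIdeal
          (𝒜 := homogeneousSubmodule (Fin (d + 1 + 1)) B.left.functionField)
            ((iK (d + 1) B X i).base y)).toIdeal ↔ ∀ v ∈ ℓ, eval v G = 0) →
      (∀ G : MvPolynomial (Fin (d + 1 + 1)) B.left.functionField,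
        G ∈ (ProjectiveSpectrum.asHomogeneousIdeal
          (𝒜 := homogeneousSubmodule (Fin (d + 1 + 1)) B.left.functionField)
            ((iK (d + 1) B X i).base y'')).toIdeal ↔ ∀ v ∈ ℓ'', eval v G = 0) →
      ∃ P : AlgebraicCycle X.left ℤ, (∀ y, P y ≠ 0 → IsLinearSubspacePoint 2 (d + 1) i y) ∧
        M (primeCycle ((ιX B X).base y)) - M (primeCycle ((ιX B X).base y'')) - P ∈
          ratTrivial X.left 2 := by
    intro ℓ ℓ'' π hℓ hℓ'' hπ hℓπ hℓ''π hπiso y y'' hy hy''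
    obtain ⟨c', hc', vert, hcv, hvert⟩ := exists_relation_of_link B X i hrange (by omega) hB1 hpid
      hℓ hℓ'' hπ hℓπ hℓ''π hπiso hy hy''
    refine ⟨-(M vert), fun z hz => key_plane vert hvert z (by
      rwa [Function.locallyFinsuppWithin.coe_neg, Pi.neg_apply, neg_ne_zero] at hz), ?_⟩
    have h := hMrat c' hc'
    rw [hcv, map_add, map_sub] at h
    convert h using 1
    abel
  -- the chain: induction over `ReflTransGen` of the coplanarity relation
  have chain : ∀ {ℓ₁ ℓ₂ : Submodule B.left.functionField (Fin (d + 1 + 1) → B.left.functionField)},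
      Relation.ReflTransGen (fun ℓ ℓ' : Submodule B.left.functionField
          (Fin (d + 1 + 1) → B.left.functionField) =>
        Module.finrank B.left.functionField ℓ = 2 ∧ Module.finrank B.left.functionField ℓ' = 2 ∧
          ∃ π : Submodule B.left.functionField (Fin (d + 1 + 1) → B.left.functionField),
            ℓ ≤ π ∧ ℓ' ≤ π ∧ Module.finrank B.left.functionField π = 3 ∧
              ∀ v ∈ π, eval v (MvPolynomial.map (algebraMap k B.left.functionField) F) = 0) ℓ₁ ℓ₂ →
      ∀ {x₁ x₂ : ↥(XK B X)},
      (∀ G : MvPolynomial (Fin (d + 1 + 1)) B.left.functionField,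
        G ∈ (ProjectiveSpectrum.asHomogeneousIdeal
          (𝒜 := homogeneousSubmodule (Fin (d + 1 + 1)) B.left.functionField)
            ((iK (d + 1) B X i).base x₁)).toIdeal ↔ ∀ v ∈ ℓ₁, eval v G = 0) →
      (∀ G : MvPolynomial (Fin (d + 1 + 1)) B.left.functionField,
        G ∈ (ProjectiveSpectrum.asHomogeneousIdeal
          (𝒜 := homogeneousSubmodule (Fin (d + 1 + 1)) B.left.functionField)
            ((iK (d + 1) B X i).base x₂)).toIdeal ↔ ∀ v ∈ ℓ₂, eval v G = 0) →
      ∃ P : AlgebraicCycle X.left ℤ, (∀ y, P y ≠ 0 → IsLinearSubspacePoint 2 (d + 1) i y) ∧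
        M (primeCycle ((ιX B X).base x₁)) - M (primeCycle ((ιX B X).base x₂)) - P ∈
          ratTrivial X.left 2 := by
    intro ℓ₁ ℓ₂ h
    induction h using Relation.ReflTransGen.head_induction_on with
    | refl =>
      intro x₁ x₂ h₁ h₂
      have heq : x₁ = x₂ := Hypersurface.eq_of_submodule_eq iK' h₁ h₂
      rw [heq]
      exact good_refl _
    | head hac _ ih =>
      intro x₁ x₂ h₁ h₂
      obtain ⟨ha2, hc2, π, haπ, hcπ, hπ3, hπiso⟩ := hac
      -- a point over the middle line
      obtain ⟨wc, hwc, hspanc⟩ := exists_frame_of_finrank_eq hc2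
      obtain ⟨xc, -, hAc⟩ := exists_point_of_frame B X i hrange (r := 1) (m := 2) rfl (by omega) hwc
        (by rw [hspanc]; exact fun v hv => hπiso v (hcπ hv))
      rw [hspanc] at hAc
      exact good_trans (good_link ha2 hc2 hπ3 haπ hcπ hπiso h₁ hAc) (ih hAc h₂)
  -- the subspace of the given line
  obtain ⟨ℓx, hℓx, hℓxiso, hAx⟩ :=
    Hypersurface.exists_submodule_of_isLinearSubspacePoint iK' hrange'
      (isLinearSubspacePoint_iK_of_id B X i hx)
  -- a `k`-line `λ₀` of `X` and the constant `K`-line `λ₀ ⊗ K`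
  obtain ⟨y₀, hy₀⟩ := exists_isLinearSubspacePoint_one_of_cubic (N := d + 1) (by omega) F hF3 i hrange
  obtain ⟨W₀, hW₀, hW₀iso, hAy₀⟩ := Hypersurface.exists_submodule_of_isLinearSubspacePoint i hrange hy₀
  obtain ⟨w₀, hw₀, hspan₀⟩ := exists_frame_of_finrank_eq hW₀
  let w₀K : Fin 2 → Fin (d + 1 + 1) → B.left.functionField :=
    fun a => algebraMap k B.left.functionField ∘ w₀ a
  have hw₀K : LinearIndependent B.left.functionField w₀K :=
    (linearIndependent_algebraMap_comp_iff (R := k) (S := B.left.functionField)).2 hw₀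
  -- polynomials over `k` vanishing on `span w₀` vanish, after base change, on `span w₀K`
  have hbc : ∀ G : MvPolynomial (Fin (d + 1 + 1)) k, (∀ v ∈ W₀, eval v G = 0) →
      ∀ v ∈ Submodule.span B.left.functionField (Set.range w₀K),
        eval v (MvPolynomial.map (algebraMap k B.left.functionField) G) = 0 := by
    intro G hG
    -- the linear forms of `W₀`: `G ∈ (L₀)` and each `L₀ l` vanishes on `span w₀K`
    obtain ⟨t, L₀, ht, hL₀, hL₀hom, hL₀van, hall⟩ :=
      exists_linearForms_forall_mem_ideal_span_vanishing hw₀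
    rw [hspan₀] at hL₀van hall
    have hGmem : G ∈ Ideal.span (Set.range L₀) := hall G hG
    -- membership is preserved by `map`
    have hGmemK : MvPolynomial.map (algebraMap k B.left.functionField) G ∈
        Ideal.span (Set.range fun l => MvPolynomial.map (algebraMap k B.left.functionField) (L₀ l)) := by
      have h := Ideal.mem_map_of_mem (MvPolynomial.map (algebraMap k B.left.functionField)) hGmem
      rw [Ideal.map_span, ← Set.range_comp] at h
      exact h
    -- each mapped linear form vanishes on `span w₀K`
    have hLK : ∀ l, ∀ v ∈ Submodule.span B.left.functionField (Set.range w₀K),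
        eval v (MvPolynomial.map (algebraMap k B.left.functionField) (L₀ l)) = 0 := by
      intro l
      refine forall_mem_span_eval_eq_zero_of_isHomogeneous_one ((hL₀hom l).map _) ?_
      rintro _ ⟨a, rfl⟩
      rw [MvPolynomial.eval_map, show w₀K a = algebraMap k B.left.functionField ∘ w₀ a from rfl]
      have h := MvPolynomial.eval₂_comp_left (algebraMap k B.left.functionField) (RingHom.id k)
        (w₀ a) (L₀ l)
      rw [RingHom.comp_id] at h
      rw [← h]
      change algebraMap k B.left.functionField (eval (w₀ a) (L₀ l)) = 0
      rw [hL₀van l (w₀ a) (by rw [← hspan₀]; exact Submodule.subset_span ⟨a, rfl⟩), map_zero]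
    intro v hv
    have hle : Ideal.span (Set.range fun l => MvPolynomial.map (algebraMap k B.left.functionField) (L₀ l)) ≤
        RingHom.ker (eval v) := by
      rw [Ideal.span_le]
      rintro _ ⟨l, rfl⟩
      exact (RingHom.mem_ker).2 (hLK l v hv)
    exact (RingHom.mem_ker).1 (hle hGmemK)
  have hℓ₀iso : ∀ v ∈ Submodule.span B.left.functionField (Set.range w₀K),
      eval v (MvPolynomial.map (algebraMap k B.left.functionField) F) = 0 := hbc F hW₀iso
  obtain ⟨x₀, hx₀1, hAx₀⟩ := exists_point_of_frame B X i hrange (r := 1) (m := 2) rfl (by omega)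
    hw₀K hℓ₀iso
  have hℓ₀ : Module.finrank B.left.functionField
      ↥(Submodule.span B.left.functionField (Set.range w₀K)) = 2 := by
    rw [finrank_span_eq_card hw₀K, Fintype.card_fin]
  -- the constant line is contracted: `M [ι x₀] = 0`
  have hM₀ : M (primeCycle ((ιX B X).base x₀)) = 0 := by
    change AlgebraicCycle.map (CartesianMonoidalCategory.fst X B).left height height _ = _
    rw [algebraicCycleMap_primeCycle_eq_nsmul]
    -- `ι x₀` has dimension `2`
    have h2 : height ((ιX B X).base x₀) = 2 := by
      let V : ClosedSubvariety (XK B X) := ClosedSubvariety.ofPoint _ x₀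
      have hdV := dim_image_eq hP hi hB1 V
      have hV : V.dim = 1 := by
        change height V.genericPoint = 1
        rw [ClosedSubvariety.genericPoint_ofPoint,
          ← height_base_eq_of_isClosedImmersion' (iK (d + 1) B X i), hx₀1.height_eq]
        rfl
      have hI : (V.image (ιX B X)).dim = height ((ιX B X).base x₀) := by
        change height (V.image (ιX B X)).genericPoint = _
        rw [ClosedSubvariety.genericPoint_image, ClosedSubvariety.genericPoint_ofPoint]
      rw [← hI, hdV, hV]
      rfl
    -- its projection lies on the `k`-line `closure {y₀}`, of dimension `≤ 1`
    have hle1 : height ((CartesianMonoidalCategory.fst X B).left.base ((ιX B X).base x₀)) ≤ 1 := by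
      -- `i (pr₁ (ι x₀)) = π (iK x₀)` specialises from `i y₀`
      have hproj : i.left.base ((CartesianMonoidalCategory.fst X B).left.base ((ιX B X).base x₀)) =
          (Proj.map (mapGraded k B.left.functionField (Fin (d + 1 + 1)))
            (irrelevant_le_map k B.left.functionField (Fin (d + 1 + 1)))).base
              ((iK (d + 1) B X i).base x₀) := by
        have h1 : (CartesianMonoidalCategory.fst (projectiveSpace (d + 1) k) B).left.base
            ((i ▷ B).left.base ((ιX B X).base x₀)) =
              i.left.base ((CartesianMonoidalCategory.fst X B).left.base ((ιX B X).base x₀)) := by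
          change (((i ▷ B).left ≫ (CartesianMonoidalCategory.fst (projectiveSpace (d + 1) k) B).left).base
            ((ιX B X).base x₀)) = _
          rw [whiskerRight_left_fst]
          rfl
        have h2 : (i ▷ B).left.base ((ιX B X).base x₀) =
            (genericFibreι (d + 1) B).base ((iK (d + 1) B X i).base x₀) := by
          change ((ιX B X ≫ (i ▷ B).left).base x₀) = ((iK (d + 1) B X i ≫ genericFibreι (d + 1) B).base x₀)
          rw [iK_genericFibreι]
        have h3 : (CartesianMonoidalCategory.fst (projectiveSpace (d + 1) k) B).left.base
            ((genericFibreι (d + 1) B).base ((iK (d + 1) B X i).base x₀)) =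
              (Proj.map (mapGraded k B.left.functionField (Fin (d + 1 + 1)))
                (irrelevant_le_map k B.left.functionField (Fin (d + 1 + 1)))).base
                  ((iK (d + 1) B X i).base x₀) := by
          change ((genericFibreι (d + 1) B ≫
            (CartesianMonoidalCategory.fst (projectiveSpace (d + 1) k) B).left).base _) = _
          rw [genericFibreι_fst]
          rfl
        rw [← h1, h2, h3]
      -- all polynomials vanishing on `W₀` lie in `𝔭(i (pr₁ (ι x₀)))`
      have hspec : i.left.base y₀ ⤳
          i.left.base ((CartesianMonoidalCategory.fst X B).left.base ((ιX B X).base x₀)) := by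
        refine ProjSpace.specializes_iff_le.2 fun G hG => ?_
        rw [hproj]
        have hGW : ∀ v ∈ W₀, eval v G = 0 := (hAy₀ G).1 hG
        have hGK := (hAx₀ (MvPolynomial.map (algebraMap k B.left.functionField) G)).2 (hbc G hGW)
        exact (HomogeneousIdeal.mem_iff).1
          ((ProjectiveSpectrum.mem_asHomogeneousIdeal_map_iff _ G).2 ((HomogeneousIdeal.mem_iff).2 hGK))
      have hspecX : y₀ ⤳ (CartesianMonoidalCategory.fst X B).left.base ((ιX B X).base x₀) :=
        i.left.isClosedEmbedding.isInducing.specializes_iff.1 hspec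
      have hle := height_mono (Scheme.le_iff_specializes.2 hspecX)
      rw [hy₀.height_eq] at hle
      exact_mod_cast hle
    have hne : height ((ιX B X).base x₀) ≠
        height ((CartesianMonoidalCategory.fst X B).left.base ((ιX B X).base x₀)) := by
      rw [h2]
      intro h
      rw [← h] at hle1
      exact absurd hle1 (by norm_num)
    rw [AlgebraicCycle.mapCoeff, if_neg hne, zero_smul]
  -- the chain from `ℓx` to the constant line, and the conclusion
  have hchain := reflTransGen_coplanar_of_isCrSystem_one hK (by omega) hF3K hℓx hℓ₀ hℓxiso hℓ₀iso
  obtain ⟨P, hP, hrat⟩ := chain hchain hAx hAx₀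
  rw [hM₀, sub_zero] at hrat
  haveI : CompactSpace ↥X.left := by
    haveI : QuasiCompact X.hom := inferInstance
    exact compactSpace_of_quasiCompact_hom X
  refine ⟨(finite_support_of_compactSpace P).toFinset, fun y => P y, fun y hy => hP y
    (Function.mem_support.mp ((Set.Finite.mem_toFinset _).mp hy)), ?_⟩
  change _ - ∑ y ∈ (finite_support_of_compactSpace P).toFinset, P y • primeCycle y ∈ ratTrivial X.left 2
  rw [← eq_sum_smul_primeCycle_of_support_subset P (s := (finite_support_of_compactSpace P).toFinset)
    (by rw [Set.Finite.coe_toFinset])]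
  exact hrat

end Main

end ProjFamily

end Literature.AlgebraicGeometry.Motives

end
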